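import Literature.NumberTheory.EllipticCurves.TateCurve.WeierstrassPDerivQExpansion
import Literature.NumberTheory.EllipticCurves.UniformizationProofs
import Literature.NumberTheory.EllipticCurves.SteinWuthrich2013.MultiplicativeLeadingTerm
import HarnessLib

/-!
# Tate's complex parametrisation: `(X(u,q), Y(u,q))` lies on `E_q : y² + xy = x³ + a₄(q)x + a₆(q)`
# (Silverman, *Advanced Topics*, Thm. V.1.1) — PROVED for `|q| < |u| < 1`

Topic `Literature/NumberTheory/EllipticCurves/TateCurve`, namespace
`Literature.NumberTheory.EllipticCurves.TateCurve` (abc-iut cell, TRANCHE-T1 P21; sub-lemma U-1c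
of the discharge plan of the named fact `uniformization`: Silverman's proof of V.3.1 (c) transports
exactly this complex identity to `ℚ(u)⟦q⟧` and then to `p`-adic fields).

For `τ ∈ ℍ`, `0 < Im z < Im τ`, `q = e^{2πiτ}`, `u = e^{2πiz}` (so `|q| < |u| < 1`), with
`T(t) = t/(1−t)²`, `W(t) = t²/(1−t)³`, `s₁'(q) = Σ_{n ≥ 1} T(qⁿ)` (`= s₁(q)`, ATAEC Rem. V.1.2) and

  `X = Σ_{n ∈ ℤ} T(qⁿu) − 2 s₁'(q)`,   `Y = Σ_{n ∈ ℤ} W(qⁿu) + s₁'(q)`,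

one has **`Y² + XY = X³ + a₄(q) X + a₆(q)`** with the tree's `a₄(q) = tateA4 q = −5 s₃(q)`,
`a₆(q) = tateA6 q = −(5 s₃(q) + 7 s₅(q))/12` evaluated in `ℂ` (`complexTate_onCurve`).
Proof as in ATAEC V §1 (PDF pp. 385–386): `℘ = (2πi)²(X + 1/12)` (`weierstrassP_ofUpperHalfPlane_eq`),
`℘' = (2πi)³(2Y + X)` (`derivWeierstrassP_ofUpperHalfPlane_eq`, `V = T + 2W`),
`℘'² = 4℘³ − g₂℘ − g₃` (Mathlib `PeriodPair.derivWeierstrassP_sq`), `g₂ = (4π⁴/3)E₄`,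
`g₃ = (8π⁶/27)E₆` (tree `PeriodPair.g₂_ofUpperHalfPlane`, `g₃_ofUpperHalfPlane`), and
`E₄ = 1 + 240 s₃(q)`, `E₆ = 1 − 504 s₅(q)` (`E₄_eq_tateE4`, `E₆_eq_tateE6`, from Mathlib's
`EisensteinSeries.q_expansion_bernoulli`); then "a little algebra".

## References
* [SilvermanATAEC1994] J. H. Silverman, *Advanced Topics in the Arithmetic of Elliptic Curves*,
  GTM 151, Springer 1994, Ch. V §1, Thm. V.1.1 (a) (PDF pp. 385–386) and Ch. I §§6–7.
-/

noncomputable section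

open Complex Real Filter Topology
open UpperHalfPlane hiding I
open scoped PeriodPair ArithmeticFunction.sigma

namespace Literature.NumberTheory.EllipticCurves.TateCurve

open SteinWuthrich2013

/-- `W(t) = t²/(1 − t)³`, the summand of Tate's `Y(u,q)` (`Y = Σ W(qⁿu) + s₁`; `V = T + 2W`).
[cite: SilvermanATAEC1994, Thm. V.1.1 (PDF p. 386)] -/
def wFun (t : ℂ) : ℂ := t ^ 2 / (1 - t) ^ 3

/-- `V(t) = T(t) + 2 W(t)`. [cite: SilvermanATAEC1994, Thm. V.1.1 (PDF p. 386)] -/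
theorem vFun_eq (t : ℂ) : vFun t = tFun t + 2 * wFun t := by
  rcases eq_or_ne t 1 with rfl | ht1
  · simp [vFun, tFun, wFun]
  have h1 : (1 - t) ≠ 0 := sub_ne_zero.mpr (Ne.symm ht1)
  rw [vFun, tFun, wFun]
  field_simp
  ring

/-- `E₄(τ) = tateE4 (e^{2πiτ}) = 1 + 240 Σ σ₃(n) qⁿ` (Mathlib `q_expansion_bernoulli`, `B₄ = −1/30`).
[cite: SilvermanATAEC1994, Ch. V §1 (PDF p. 385, "(I.7.3.2)")] -/
theorem E₄_eq_tateE4 (τ : ℍ) : ModularForm.E₄ τ = tateE4 (cexp (2 * π * I * τ)) := by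
  have h := EisensteinSeries.q_expansion_bernoulli (k := 4) (by norm_num) (by decide) τ
  have hb : (bernoulli 4 : ℚ) = -1 / 30 := by
    rw [bernoulli_eq_bernoulli'_of_ne_one (by norm_num), bernoulli'_four]
  have hcoef : (2 * (4 : ℕ) / (bernoulli 4 : ℚ) : ℂ) = -240 := by
    rw [hb]; push_cast; norm_num
  rw [show ModularForm.E₄ τ = ModularForm.E (by norm_num : 3 ≤ 4) τ from rfl, h]
  simp only [Nat.cast_ofNat] at hcoef ⊢
  rw [show (2 * 4 / ((bernoulli 4 : ℚ) : ℂ)) = -240 by exact_mod_cast hcoef]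
  rw [show tateE4 (cexp (2 * π * I * τ)) =
      1 + 240 * ∑' n : ℕ, ((σ 3 (n + 1) : ℕ) : ℂ) * cexp (2 * π * I * τ) ^ (n + 1) from rfl]
  rw [← tsum_pnat_eq_tsum_succ (f := fun n : ℕ ↦ (σ 3 n : ℂ) * cexp (2 * π * I * τ) ^ n)]
  rw [neg_mul, sub_neg_eq_add]
  congr 2

/-- `E₆(τ) = 1 − 504 s₅(q) = 1 − 504 · tateS 5 (e^{2πiτ})` (Mathlib `q_expansion_bernoulli`,
`B₆ = 1/42`). [cite: SilvermanATAEC1994, Ch. V §1 (PDF p. 385, "(I.7.3.2)")] -/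
theorem E₆_eq_tateS (τ : ℍ) : ModularForm.E₆ τ = 1 - 504 * tateS 5 (cexp (2 * π * I * τ)) := by
  have h := EisensteinSeries.q_expansion_bernoulli (k := 6) (by norm_num) (by decide) τ
  have hb : (bernoulli 6 : ℚ) = 1 / 42 := by
    rw [bernoulli_eq_bernoulli'_of_ne_one (by norm_num), PeriodPair.bernoulli'_six]
  have hcoef : (2 * (6 : ℕ) / (bernoulli 6 : ℚ) : ℂ) = 504 := by
    rw [hb]; push_cast; norm_num
  rw [show ModularForm.E₆ τ = ModularForm.E (by norm_num : 3 ≤ 6) τ from rfl, h]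
  simp only [Nat.cast_ofNat] at hcoef ⊢
  rw [show (2 * 6 / ((bernoulli 6 : ℚ) : ℂ)) = 504 by exact_mod_cast hcoef]
  rw [show tateS 5 (cexp (2 * π * I * τ)) =
      ∑' n : ℕ, ((σ 5 (n + 1) : ℕ) : ℂ) * cexp (2 * π * I * τ) ^ (n + 1) from rfl]
  rw [← tsum_pnat_eq_tsum_succ (f := fun n : ℕ ↦ (σ 5 n : ℂ) * cexp (2 * π * I * τ) ^ n)]
  congr 2

/-- `z ∉ ℤτ + ℤ` when `0 < Im z < Im τ`. [folklore] -/
private theorem notMem_lattice_of_im (τ : ℍ) {z : ℂ} (hz0 : 0 < z.im) (hz1 : z.im < τ.im) :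
    z ∉ (PeriodPair.ofUpperHalfPlane τ).lattice := by
  intro hz
  rw [PeriodPair.mem_lattice] at hz
  obtain ⟨c, d, hcd⟩ := hz
  have him : z.im = (c : ℝ) * τ.im := by
    rw [← hcd]
    simp [PeriodPair.ofUpperHalfPlane]
  have hτ := τ.im_pos
  rcases le_or_gt c 0 with hc0 | hc0
  · have : (c : ℝ) * τ.im ≤ 0 := mul_nonpos_of_nonpos_of_nonneg (by exact_mod_cast hc0) hτ.le
    linarith
  · have hc1 : (1 : ℝ) ≤ c := by exact_mod_cast hc0
    have : τ.im ≤ (c : ℝ) * τ.im := le_mul_of_one_le_left hτ.le hc1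
    linarith

/-- **Silverman ATAEC Thm. V.1.1 (a) (complex Tate parametrisation), PROVED on `|q| < |u| < 1`:**
for `τ ∈ ℍ`, `0 < Im z < Im τ`, `q = e^{2πiτ}`, `u = e^{2πiz}`, the values
`X = Σ_{n∈ℤ} qⁿu/(1−qⁿu)² − 2s₁'(q)`, `Y = Σ_{n∈ℤ} (qⁿu)²/(1−qⁿu)³ + s₁'(q)`
(`s₁'(q) = Σ_{n≥1} qⁿ/(1−qⁿ)²`) satisfy the Tate equation
`Y² + XY = X³ + a₄(q)X + a₆(q)` with `a₄(q) = −5s₃(q)`, `a₆(q) = −(5s₃(q) + 7s₅(q))/12`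
(the tree's `tateA4`, `tateA6` at `K = ℂ`). "using the series for `g₂, g₃, ℘, ℘'` and doing a little
algebra" (PDF p. 386). [cite: SilvermanATAEC1994, Thm. V.1.1 (a) (PDF pp. 385–386)] -/
theorem complexTate_onCurve (τ : ℍ) {z : ℂ} (hz0 : 0 < z.im) (hz1 : z.im < τ.im) :
    let q := cexp (2 * π * I * τ)
    let u := cexp (2 * π * I * z)
    let s₁ := ∑' n : ℕ, tFun (q ^ (n + 1))
    let X := ∑' n : ℤ, tFun (q ^ n * u) - 2 * s₁
    let Y := ∑' n : ℤ, wFun (q ^ n * u) + s₁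
    Y ^ 2 + X * Y = X ^ 3 + tateA4 q * X + tateA6 q := by
  intro q u s₁ X Y
  set L := PeriodPair.ofUpperHalfPlane τ with hL
  have hq1 : ‖q‖ < 1 := norm_exp_two_pi_I_lt_one τ
  -- `℘ = c²(X + 1/12)`, `℘' = c³(2Y + X)`, `c = 2πi`
  have hP : ℘[L] z = (2 * π * I) ^ 2 * (X + 1 / 12) := by
    rw [hL, weierstrassP_ofUpperHalfPlane_eq τ hz0 hz1]
    ring
  have hsumV : ∑' n : ℤ, vFun (q ^ n * u) = ∑' n : ℤ, tFun (q ^ n * u) + 2 * ∑' n : ℤ, wFun (q ^ n * u) := by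
    have hT := summable_tFun_zpow_mul hq1 u
    have hV := summable_vFun_zpow_mul hq1 u
    have hW : Summable fun n : ℤ ↦ wFun (q ^ n * u) := by
      have := (hV.sub hT).div_const 2
      refine this.congr fun n ↦ ?_
      rw [vFun_eq]; ring
    rw [← tsum_mul_left, ← hT.tsum_add (hW.mul_left 2)]
    exact tsum_congr fun n ↦ by rw [vFun_eq]
  have hP' : ℘'[L] z = (2 * π * I) ^ 3 * (2 * Y + X) := by
    rw [hL, derivWeierstrassP_ofUpperHalfPlane_eq τ hz0 hz1, hsumV]
    ring
  -- the Weierstrass equation and the Eisenstein values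
  have hW := L.derivWeierstrassP_sq z (notMem_lattice_of_im τ hz0 hz1)
  have hg2 : L.g₂ = (4 * (π : ℂ) ^ 4 / 3) * tateE4 q := by
    rw [hL, PeriodPair.g₂_ofUpperHalfPlane, E₄_eq_tateE4]
  have hg3 : L.g₃ = (8 * (π : ℂ) ^ 6 / 27) * (1 - 504 * tateS 5 q) := by
    rw [hL, PeriodPair.g₃_ofUpperHalfPlane, E₆_eq_tateS]
  rw [hP, hP', hg2, hg3] at hW
  have hE4 : tateE4 q = 1 + 240 * tateS 3 q := rfl
  rw [hE4] at hW
  have hI : (I : ℂ) ^ 2 = -1 := Complex.I_sq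
  have hπ : (π : ℂ) ≠ 0 := by exact_mod_cast Real.pi_ne_zero
  simp only [tateA4, tateA6]
  -- divide the Weierstrass relation by `(2πi)⁶ = -64π⁶`
  have key : (2 * Y + X) ^ 2 = 4 * (X + 1 / 12) ^ 3
      - ((1 + 240 * tateS 3 q) / 12) * (X + 1 / 12) + (1 - 504 * tateS 5 q) / 216 := by
    have h2 : (2 * π * I : ℂ) ^ 2 = -4 * π ^ 2 := by
      rw [mul_pow, hI]; ring
    rw [show ((2 * π * I : ℂ) ^ 3 * (2 * Y + X)) ^ 2 = ((2 * π * I) ^ 2) ^ 3 * (2 * Y + X) ^ 2 by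
      ring, show ((2 * π * I : ℂ) ^ 2 * (X + 1 / 12)) ^ 3 = ((2 * π * I) ^ 2) ^ 3 * (X + 1 / 12) ^ 3
      by ring, h2] at hW
    have hπ6 : (π : ℂ) ^ 6 ≠ 0 := pow_ne_zero 6 hπ
    apply mul_left_cancel₀ (show (-64 * (π : ℂ) ^ 6) ≠ 0 by
      exact mul_ne_zero (by norm_num) hπ6)
    linear_combination hW
  linear_combination (1 / 4 : ℂ) * key

end Literature.NumberTheory.EllipticCurves.TateCurve

end
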